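import Summits.BirchSwinnertonDyer.BirchSwinnertonDyer.Theses.KimAtThreeKolyvagin
import Summits.BirchSwinnertonDyer.Rank1Residual.Additive.X4RankZeroKatoBound
import Summits.BirchSwinnertonDyer.Rank1Residual.X4.OptimalPeriod
import Literature.NumberTheory.EllipticCurves.KuriharaNumberKimStructureProofs
import HarnessLib

/-!
# Route `KimAtThreeKolyvagin` (rung W2), crux `DeepUpperAtThree`: its first RUNGS, proved from print

The crux `DeepUpperAtThree` (item `stmt-BirchSwinnertonDyer-19076`) asks, for every `E/ℚ` (globally
minimal `W`) with the `3`-adic tower onto, `Ш(E/ℚ)` finite and newform `f` with `3`-integral plus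
symbols and `ord(δ̃) = 0`: `∂^{(∞)}_{deep}(δ̃) = d ∈ ℕ` and `ord₃ #Ш(E/ℚ)(3) + d ≤ ∂⁽⁰⁾(δ̃)` — the
Kato-side half of Kim's `p = 3` structure theorem (arXiv:2505.09121 Thm 1.1/1.2). Dropping the deep
term `d ≥ 0` leaves the TRUNCATION `ord₃ #Ш(E/ℚ)(3) ≤ ∂⁽⁰⁾(δ̃)` (`= ord₃ [0]⁺_f`, Kim §1.5.1), and on
the stratum where Kato's Thm. 14.5 (3) with Prop. 14.16 (2) is IN PRINT — `3` additive and
potentially good, Kato's (12.5.2) (which the tower gives: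
`Kato2004.imageContainsSL2_of_forall_hasSurjectiveModNGaloisRep`) — that truncation is the tree's
named PUBLISHED facts of `Literature/…/Kato2004/AdditivePotGoodRankZeroShaUpperBound.lean`
(`ord₃ #Ш(3) ≤ ord₃(L(E,1)/Ω(W))`, resp. `… + v₃(∏ c_ℓ) ≤ …`), read through
`L(E,1) = [0]⁺_f · Ω⁺_f` (`IsNewformOf.entireLFunction_one_eq`) and the period transfer
`Ω(W) = u · Ω⁺_f`, `|u|₃ = 1` (the cell's displayed binder `hper`, REF-kim3 C10-R; discharged under
optimality by `X4.periodTransfer_of_optimal`).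

Contents (every printed input is a hypothesis BY NAME; nothing is asserted; the crux stays open):
* `natCast_le_kuriharaPartial_zero_of_le_padicValRat` — the bridge BSD currency ⇒ `∂`-currency:
  `L(E,1)/Ω(W) = q`, `m ≤ ord_p q` ⟹ `m ≤ ∂⁽⁰⁾(δ̃)` (odd `p`, `E[p]` irreducible, `hper`).
* `deepUpperAtThree_truncation_potGood_of_kato2004` — THE RUNG on the binders of the fact the
  route's birth certificate names (BC5: `Kato2004.rankZero_padicValNat_sha_le_of_additive_potGood_of_imageContainsSL2`;
  extra binders `3 ∤ ∏ c_ℓ` and a parametrisation datum with `3 ∤ c_D`).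
* `deepUpperAtThree_truncation_potGood_of_kato2004ManinFree` — the same rung WITHOUT the Tamagawa
  and Manin binders, from the Manin-free reading `…_sub_localTamagawa_…_maninFree` (covers the
  `c₃ = 3` Kodaira IV / IV* rows where the cell memo located Kim's Lemma 3.10 deviation).
* `deepUpperAtThree_truncation_potGood_of_kato2004_of_optimal` — `hper` discharged by optimality.
* `truncation_potGood_of_deepUpperAtThree`, `truncationManinFree_potGood_of_deepUpperAtThree` —
  kernel certificates that both statements ARE rungs of the crux (`DeepUpperAtThree` implies them).
* `sha_add_tamagawa_le_kuriharaPartial_zero_of_kato2004TamagawaExact` — the Tamagawa-EXACT reading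
  in the crux's currency: `ord₃ #Ш(3) + v₃(∏ c_ℓ) ≤ ∂⁽⁰⁾(δ̃)` (not a rung: it is the crux's inequality
  with `d` replaced by `v₃(∏ c_ℓ)`, Kim's conjectural value of `∂^{(∞)}`).
* `tamagawa_le_kuriharaPartialDeepInfty_of_deepLowerAtThree_of_kato2004TamagawaExact` — a kernel
  CONSEQUENCE linking the two deep cruxes to print: the rigidity crux `DeepLowerAtThree`
  (`∂⁽⁰⁾ ≤ ord₃ #Ш(3) + ∂^{(∞)}_{deep}`) together with the Tamagawa-exact reading forces
  `v₃(∏ c_ℓ) ≤ ∂^{(∞)}_{deep}(δ̃)` on the stratum — one half of Kim's Tamagawa-defect prediction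
  (AJM 148 Conj. 1.10) at `p = 3`, conditional on the crux by name.

This file is the cell's T3 WITNESS OF WEAKNESS for the tribunal of route `KimAtThreeKolyvagin`: a
proved rung of the attacked crux on a regime where the leaf `N11.KimAtThreeRankZeroPUB` (the
EQUALITY `∂⁽⁰⁾ = ord₃ #Ш(3) + ∂^{(∞)}`) is open.
[cite: Kato2004Asterisque, Thm. 14.5 (3) (p. 236), Prop. 14.16 (2) (p. 244), (12.5.2) (p. 222), §14.8 (p. 238)]
[cite: GreenbergLNM1716, Prop. 4.13, §4] [cite: Kim2022StructureSelmer, §1.4.3 and §1.5.1 (PDF p. 7), Conj. 1.10 (PDF p. 8)]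
[cite: Kim2025RefinedTNC, Thm 1.1, Thm 1.2]
-/

set_option autoImplicit false
-- the Theorems namespace of a single-conjunct summit repeats the summit name by design (D-0017)
set_option linter.dupNamespace false

noncomputable section

open scoped MatrixGroups ModularForm Classical

open CongruenceSubgroup WeierstrassCurve Literature.NumberTheory.EllipticCurves
  Literature.NumberTheory.EllipticCurves.ModularForms

namespace Summit.BirchSwinnertonDyer.BirchSwinnertonDyer.Theorems.KimAtThreeKolyvaginDeepUpperRung

open Summit.BirchSwinnertonDyer.Rank1Residual.Additive
open Summit.BirchSwinnertonDyer.BirchSwinnertonDyer.Theses.KimAtThreeKolyvagin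

/-! ### The bridge: BSD currency ⇒ `∂`-currency at the level `n = 1` -/

section Bridge

variable (W : WeierstrassCurve ℚ) [W.IsElliptic] [W.IsGloballyMinimal] (p : ℕ) [Fact p.Prime]
  {N : ℕ} [NeZero N] (f : CuspForm (Gamma0 N) 2)

omit [W.IsElliptic] [Fact p.Prime] [NeZero N] in
/-- If `[0]⁺_f = 0` then `δ̃_1 = 0` is divisible by every power of `p`: `∂⁽⁰⁾(δ̃) = ⊤`.
[cite: Kim2022StructureSelmer, §1.4.3 and §1.5.1 (PDF p. 7)] -/
theorem kuriharaPartial_zero_eq_top_of_ratPlusSymbol_eq_zero (h0 : ratPlusSymbol f 0 = 0) :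
    kuriharaPartial W p f 0 = ⊤ := by
  rw [kuriharaPartial_zero, ENat.eq_top_iff_forall_ge]
  intro j
  refine le_kuriharaDivIndex_of_divisibleAt W p f ?_
  rw [kuriharaDivisibleAt_one_iff]
  intro k _
  rw [h0, ratModP_zero]

/-- **BSD currency ⇒ `∂`-currency.** For odd `p`, `E[p]` irreducible (so `[0]⁺_f` is `p`-integral),
`f` the newform of `W` and the period transfer `Ω(W) = u · Ω⁺_f`, `|u|_p = 1`: if `L(E,1)/Ω(W) = q`
and `m ≤ ord_p q` for a natural number `m`, then `m ≤ ∂⁽⁰⁾(δ̃)` in `ℕ∞` (`L(E,1) = [0]⁺_f · Ω⁺_f`, so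
`q = [0]⁺_f / u` and `ord_p q = ord_p [0]⁺_f = ∂⁽⁰⁾(δ̃)`; if `[0]⁺_f = 0` the right side is `⊤`).
[cite: Kim2022StructureSelmer, §1.4.3 and §1.5.1 (PDF p. 7)] [cite: MazurTateTeitelbaum1986Invent, §I.8 (8.6)] -/
theorem natCast_le_kuriharaPartial_zero_of_le_padicValRat (hp2 : p ≠ 2)
    (hirr : W.HasIrreducibleModPGaloisRep p) (hf : IsNewformOf W f)
    (hper : ∃ u : ℚ, ‖(u : ℚ_[p])‖ = 1 ∧ W.realPeriodRat = u * plusPeriod f)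
    {q : ℚ} (hq : W.entireLFunction 1 / (W.realPeriodRat : ℂ) = (q : ℂ)) {m : ℕ}
    (hm : (m : ℤ) ≤ padicValRat p q) : (m : ℕ∞) ≤ kuriharaPartial W p f 0 := by
  by_cases h0 : ratPlusSymbol f 0 = 0
  · rw [kuriharaPartial_zero_eq_top_of_ratPlusSymbol_eq_zero W p f h0]
    exact le_top
  · have hint0 : ¬ p ∣ (ratPlusSymbol f 0).den :=
      not_dvd_den_of_norm_ratCast_le_one (norm_ratPlusSymbol_le_one_of_irreducible hp2 hf hirr 0)
    have hΩf : 0 < plusPeriod f := IsNewform0.plusPeriod_pos_holds hf.1 hf.coeffField_eq_bot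
    obtain ⟨u, hu, hΩ⟩ := hper
    have hu0 : u ≠ 0 := by
      rintro rfl
      rw [Rat.cast_zero, norm_zero] at hu
      exact zero_ne_one hu
    -- `q = [0]⁺_f / u`
    have hq' : q = ratPlusSymbol f 0 / u := by
      have hu' : (u : ℂ) ≠ 0 := by exact_mod_cast hu0
      have hΩf' : ((plusPeriod f : ℝ) : ℂ) ≠ 0 := by exact_mod_cast hΩf.ne'
      have h1 : (q : ℂ) = ((ratPlusSymbol f 0 / u : ℚ) : ℂ) := by
        rw [← hq, hf.entireLFunction_one_eq, hΩ]
        push_cast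
        field_simp
      exact_mod_cast h1
    -- `ord_p u = 0` (a rational `p`-adic unit)
    have hvu : padicValRat p u = 0 := by
      have hu0' : (u : ℚ_[p]) ≠ 0 := by exact_mod_cast hu0
      have h1 := hu
      rw [Padic.norm_eq_zpow_neg_valuation hu0', Padic.valuation_ratCast] at h1
      have hp1 : (1 : ℝ) < (p : ℝ) := by exact_mod_cast (Fact.out : p.Prime).one_lt
      have h2 := (zpow_eq_one_iff_right₀ (zero_le_one.trans hp1.le) hp1.ne').mp h1
      linarith
    have hval : padicValRat p q = padicValRat p (ratPlusSymbol f 0) := by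
      rw [hq', padicValRat.div h0 hu0, hvu, sub_zero]
    rw [hval] at hm
    rw [kuriharaPartial_zero, kuriharaDivIndex_one_eq W p f hint0 h0]
    have hnat : m ≤ (padicValRat p (ratPlusSymbol f 0)).toNat := by omega
    exact_mod_cast hnat

end Bridge

/-! ### The rungs of `DeepUpperAtThree` on Kato's printed stratum -/

/-- Under the tower (use `n = 1`), `E[3]` is irreducible. [folklore] -/
private theorem irreducible_three_of_tower (W : WeierstrassCurve ℚ) [W.IsElliptic]
    (htower : ∀ n : ℕ, W.HasSurjectiveModNGaloisRep (3 ^ n : ℕ)) :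
    W.HasIrreducibleModPGaloisRep 3 :=
  hasIrreducibleModPGaloisRep_of_hasSurjectiveModNGaloisRep W 3 (by simpa using htower 1)

/-- **Rung of `DeepUpperAtThree` from the fact the birth certificate names** (`hKato` = Kato 2004
Thm. 14.5 (3) + Prop. 14.16 (2) at an additive potentially good `3`, reading with the Tamagawa binder
and a Manin datum). For `W/ℚ` globally minimal with `ρ̄_{E,3^n}` onto for all `n`, `Ш(E/ℚ)` finite,
`f` the newform of `W` (the crux's integrality and `ord(δ̃) = 0` binders carried verbatim, unused),
`3` ADDITIVE and POTENTIALLY GOOD (`0 ≤ ord₃ j`), `3 ∤ ∏ c_ℓ`, the period transfer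
`Ω(W) = u · Ω⁺_f` with `|u|₃ = 1`, and a parametrisation datum `D` with `3 ∤ c_D`:
`ord₃ #Ш(E/ℚ)(3) ≤ ∂⁽⁰⁾(δ̃)` — the crux's inequality with the deep term dropped.
[cite: Kato2004Asterisque, Thm. 14.5 (3) (p. 236), Prop. 14.16 (2) (p. 244), (12.5.2) (p. 222)]
[cite: Kim2022StructureSelmer, §1.5.1 (PDF p. 7)] -/
theorem deepUpperAtThree_truncation_potGood_of_kato2004
    (hKato : Kato2004.rankZero_padicValNat_sha_le_of_additive_potGood_of_imageContainsSL2) :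
    ∀ (W : WeierstrassCurve ℚ) [W.IsElliptic] [W.IsGloballyMinimal],
      (∀ n : ℕ, W.HasSurjectiveModNGaloisRep (3 ^ n : ℕ)) →
      Finite W.sha →
      ∀ {N : ℕ} [NeZero N] (f : CuspForm (Gamma0 N) 2), IsNewformOf W f →
      (∀ r : ℚ, ratPlusSymbol f r ≠ 0 → 0 ≤ padicValRat 3 (ratPlusSymbol f r)) →
      kuriharaVanishingOrder W 3 f = 0 →
      ¬ W.HasGoodReductionAtPrime 3 → ¬ W.HasMultiplicativeReductionAtPrime 3 →
      0 ≤ padicValRat 3 W.j →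
      ¬ 3 ∣ W.tamagawaProduct →
      (∃ u : ℚ, ‖(u : ℚ_[3])‖ = 1 ∧ W.realPeriodRat = u * plusPeriod f) →
      ∀ {N' : ℕ} [NeZero N'] (D : ModularParametrizationData W N'), ¬ (3 : ℤ) ∣ D.maninConstant →
        ((padicValNat 3 (Nat.card (AddCommGroup.primaryComponent W.sha 3)) : ℕ) : ℕ∞) ≤
          kuriharaPartial W 3 f 0 := by
  intro W _ _ htower hfin N _ f hf _ _ hgood hmult hpot htam hper N' _ D hc
  by_cases h0 : ratPlusSymbol f 0 = 0
  · rw [kuriharaPartial_zero_eq_top_of_ratPlusSymbol_eq_zero W 3 f h0]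
    exact le_top
  · obtain ⟨q, hq, hle⟩ := hKato W 3 (by norm_num) hgood hmult hpot
      (Kato2004.imageContainsSL2_of_forall_hasSurjectiveModNGaloisRep W 3 htower) htam
      (hf.entireLFunction_one_ne_zero_of_ratPlusSymbol_zero_ne_zero h0) hfin D hc
    exact natCast_le_kuriharaPartial_zero_of_le_padicValRat W 3 f (by norm_num)
      (irreducible_three_of_tower W htower) hf hper hq hle

/-- **The same rung WITHOUT the Tamagawa and Manin binders**, from the Manin-free `c₃`-sharpened
reading `hKato` (Kato Thm. 14.5 (3) + Prop. 14.16 (2) with the period normalised as in Prop. 14.21 /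
14.22 and the local index `exp*_{ω_E}(H¹(ℚ₃,T)) = c₃·3^{−t}ℤ₃`): tower onto, `Ш(E/ℚ)` finite, `f` the
newform, `3` additive potentially good, `hper` ⟹ `ord₃ #Ш(E/ℚ)(3) ≤ ∂⁽⁰⁾(δ̃)` (the subtracted
`v₃(c₃) ≥ 0` is dropped). Covers the `c₃ = 3` rows (Kodaira IV, IV*).
[cite: Kato2004Asterisque, Thm. 14.5 (3) (p. 236), Prop. 14.16 (2) (p. 244), Prop. 14.21 and 14.22 (pp. 248–249)]
[cite: Kim2022StructureSelmer, §3.2.3 display before Thm. 3.7 (PDF p. 16), §1.5.1 (PDF p. 7)] -/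
theorem deepUpperAtThree_truncation_potGood_of_kato2004ManinFree
    (hKato : Kato2004.rankZero_padicValNat_sha_le_sub_localTamagawa_of_additive_potGood_of_imageContainsSL2_maninFree) :
    ∀ (W : WeierstrassCurve ℚ) [W.IsElliptic] [W.IsGloballyMinimal],
      (∀ n : ℕ, W.HasSurjectiveModNGaloisRep (3 ^ n : ℕ)) →
      Finite W.sha →
      ∀ {N : ℕ} [NeZero N] (f : CuspForm (Gamma0 N) 2), IsNewformOf W f →
      (∀ r : ℚ, ratPlusSymbol f r ≠ 0 → 0 ≤ padicValRat 3 (ratPlusSymbol f r)) →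
      kuriharaVanishingOrder W 3 f = 0 →
      ¬ W.HasGoodReductionAtPrime 3 → ¬ W.HasMultiplicativeReductionAtPrime 3 →
      0 ≤ padicValRat 3 W.j →
      (∃ u : ℚ, ‖(u : ℚ_[3])‖ = 1 ∧ W.realPeriodRat = u * plusPeriod f) →
        ((padicValNat 3 (Nat.card (AddCommGroup.primaryComponent W.sha 3)) : ℕ) : ℕ∞) ≤
          kuriharaPartial W 3 f 0 := by
  intro W _ _ htower hfin N _ f hf _ _ hgood hmult hpot hper
  by_cases h0 : ratPlusSymbol f 0 = 0
  · rw [kuriharaPartial_zero_eq_top_of_ratPlusSymbol_eq_zero W 3 f h0]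
    exact le_top
  · obtain ⟨q, hq, hle⟩ := hKato W 3 (by norm_num) hgood hmult hpot
      (Kato2004.imageContainsSL2_of_forall_hasSurjectiveModNGaloisRep W 3 htower)
      (hf.entireLFunction_one_ne_zero_of_ratPlusSymbol_zero_ne_zero h0) hfin
    have hle' : (padicValNat 3 (Nat.card (AddCommGroup.primaryComponent W.sha 3)) : ℤ) ≤
        padicValRat 3 q := by
      have h0' : (0 : ℤ) ≤ padicValNat 3 ((W.baseChange ℚ_[3]).localTamagawaNumber ℤ_[3]) := by
        positivity
      linarith
    exact natCast_le_kuriharaPartial_zero_of_le_padicValRat W 3 f (by norm_num)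
      (irreducible_three_of_tower W htower) hf hper hq hle'

/-- **The BC5 rung with the period binder DISCHARGED by optimality**: for the newform `D.f` of an
OPTIMAL parametrisation datum `D` of `W` (every point of `D`'s lattice is `c_D` times a period of
`D.f`) with `3 ∤ c_D`, `Ω(W) = |c_D| · Ω⁺_{D.f}` with `|c_D|` a `3`-adic unit
(`X4.periodTransfer_of_optimal`), so every remaining binder is a per-pair checkable datum.
[cite: Kato2004Asterisque, Thm. 14.5 (3) (p. 236), Prop. 14.16 (2) (p. 244)]
[cite: CremonaAlgorithms1997, §2.8 (p. 26)] -/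
theorem deepUpperAtThree_truncation_potGood_of_kato2004_of_optimal
    (hKato : Kato2004.rankZero_padicValNat_sha_le_of_additive_potGood_of_imageContainsSL2) :
    ∀ (W : WeierstrassCurve ℚ) [W.IsElliptic] [W.IsGloballyMinimal],
      (∀ n : ℕ, W.HasSurjectiveModNGaloisRep (3 ^ n : ℕ)) →
      Finite W.sha →
      ∀ {N : ℕ} [NeZero N] (D : ModularParametrizationData W N),
      (∀ r : ℚ, ratPlusSymbol D.f r ≠ 0 → 0 ≤ padicValRat 3 (ratPlusSymbol D.f r)) →
      kuriharaVanishingOrder W 3 D.f = 0 →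
      ¬ W.HasGoodReductionAtPrime 3 → ¬ W.HasMultiplicativeReductionAtPrime 3 →
      0 ≤ padicValRat 3 W.j →
      ¬ 3 ∣ W.tamagawaProduct →
      (∀ z ∈ D.L.lattice, ∃ w ∈ periodLattice D.f, z = D.c * w) →
      ¬ (3 : ℤ) ∣ D.maninConstant →
        ((padicValNat 3 (Nat.card (AddCommGroup.primaryComponent W.sha 3)) : ℕ) : ℕ∞) ≤
          kuriharaPartial W 3 D.f 0 := by
  intro W _ _ htower hfin N _ D hint hord hgood hmult hpot htam hopt hc
  exact deepUpperAtThree_truncation_potGood_of_kato2004 hKato W htower hfin D.f D.isNewformOf hint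
    hord hgood hmult hpot htam
    (Summit.BirchSwinnertonDyer.Rank1Residual.X4.periodTransfer_of_optimal 3 D hopt hc) D hc

/-! ### Kernel certificates: both statements are RUNGS of the crux -/

/-- `DeepUpperAtThree` implies the BC5 rung outright (drop `d`, ignore the stratum binders):
`ord₃ #Ш(3) ≤ ord₃ #Ш(3) + d ≤ ∂⁽⁰⁾(δ̃)`. [cite: Kim2025RefinedTNC, Thm 1.1] -/
theorem truncation_potGood_of_deepUpperAtThree (h : DeepUpperAtThree) :
    ∀ (W : WeierstrassCurve ℚ) [W.IsElliptic] [W.IsGloballyMinimal],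
      (∀ n : ℕ, W.HasSurjectiveModNGaloisRep (3 ^ n : ℕ)) →
      Finite W.sha →
      ∀ {N : ℕ} [NeZero N] (f : CuspForm (Gamma0 N) 2), IsNewformOf W f →
      (∀ r : ℚ, ratPlusSymbol f r ≠ 0 → 0 ≤ padicValRat 3 (ratPlusSymbol f r)) →
      kuriharaVanishingOrder W 3 f = 0 →
      ¬ W.HasGoodReductionAtPrime 3 → ¬ W.HasMultiplicativeReductionAtPrime 3 →
      0 ≤ padicValRat 3 W.j →
      ¬ 3 ∣ W.tamagawaProduct →
      (∃ u : ℚ, ‖(u : ℚ_[3])‖ = 1 ∧ W.realPeriodRat = u * plusPeriod f) →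
      ∀ {N' : ℕ} [NeZero N'] (D : ModularParametrizationData W N'), ¬ (3 : ℤ) ∣ D.maninConstant →
        ((padicValNat 3 (Nat.card (AddCommGroup.primaryComponent W.sha 3)) : ℕ) : ℕ∞) ≤
          kuriharaPartial W 3 f 0 := by
  intro W _ _ htower hfin N _ f hf hint hord _ _ _ _ _ N' _ _ _
  obtain ⟨d, -, hle⟩ := h W htower hfin f hf hint hord
  exact le_trans (by exact_mod_cast Nat.le_add_right _ d) hle

/-- `DeepUpperAtThree` implies the Manin-free rung outright. [cite: Kim2025RefinedTNC, Thm 1.1] -/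
theorem truncationManinFree_potGood_of_deepUpperAtThree (h : DeepUpperAtThree) :
    ∀ (W : WeierstrassCurve ℚ) [W.IsElliptic] [W.IsGloballyMinimal],
      (∀ n : ℕ, W.HasSurjectiveModNGaloisRep (3 ^ n : ℕ)) →
      Finite W.sha →
      ∀ {N : ℕ} [NeZero N] (f : CuspForm (Gamma0 N) 2), IsNewformOf W f →
      (∀ r : ℚ, ratPlusSymbol f r ≠ 0 → 0 ≤ padicValRat 3 (ratPlusSymbol f r)) →
      kuriharaVanishingOrder W 3 f = 0 →
      ¬ W.HasGoodReductionAtPrime 3 → ¬ W.HasMultiplicativeReductionAtPrime 3 →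
      0 ≤ padicValRat 3 W.j →
      (∃ u : ℚ, ‖(u : ℚ_[3])‖ = 1 ∧ W.realPeriodRat = u * plusPeriod f) →
        ((padicValNat 3 (Nat.card (AddCommGroup.primaryComponent W.sha 3)) : ℕ) : ℕ∞) ≤
          kuriharaPartial W 3 f 0 := by
  intro W _ _ htower hfin N _ f hf hint hord _ _ _ _
  obtain ⟨d, -, hle⟩ := h W htower hfin f hf hint hord
  exact le_trans (by exact_mod_cast Nat.le_add_right _ d) hle

/-! ### The Tamagawa-exact reading in the crux's currency, and a consequence with the rigidity crux -/

/-- **`ord₃ #Ш(E/ℚ)(3) + v₃(∏ c_ℓ) ≤ ∂⁽⁰⁾(δ̃)` on Kato's stratum**, from the Tamagawa-EXACT reading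
`hKato` (Kato Thm. 14.5 (3) + Prop. 14.16 (2) + §14.8 with Greenberg's form of Cassels' theorem for
the index `[S(T) : Sel(T)] = ∏_{ℓ ≠ 3} c_ℓ^{(3)}`): tower onto, `Ш(E/ℚ)` finite, `f` the newform,
`3` additive potentially good, `hper`. NOT a rung of `DeepUpperAtThree` (it is the crux's inequality
with the deep term replaced by `v₃(∏ c_ℓ)`, Kim's conjectural value of `∂^{(∞)}`, AJM 148 Conj. 1.10).
[cite: Kato2004Asterisque, Thm. 14.5 (3) (p. 236), Prop. 14.16 (2) (p. 244), §14.8 (p. 238)]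
[cite: GreenbergLNM1716, Prop. 4.13 and the paragraph following its proof (Cassels' theorem), §4]
[cite: Kim2022StructureSelmer, Conj. 1.10 (PDF p. 8), §1.5.1 (PDF p. 7)] -/
theorem sha_add_tamagawa_le_kuriharaPartial_zero_of_kato2004TamagawaExact
    (hKato : Kato2004.rankZero_padicValNat_sha_add_padicValNat_tamagawa_le_of_additive_potGood_of_imageContainsSL2) :
    ∀ (W : WeierstrassCurve ℚ) [W.IsElliptic] [W.IsGloballyMinimal],
      (∀ n : ℕ, W.HasSurjectiveModNGaloisRep (3 ^ n : ℕ)) →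
      Finite W.sha →
      ∀ {N : ℕ} [NeZero N] (f : CuspForm (Gamma0 N) 2), IsNewformOf W f →
      kuriharaVanishingOrder W 3 f = 0 →
      ¬ W.HasGoodReductionAtPrime 3 → ¬ W.HasMultiplicativeReductionAtPrime 3 →
      0 ≤ padicValRat 3 W.j →
      (∃ u : ℚ, ‖(u : ℚ_[3])‖ = 1 ∧ W.realPeriodRat = u * plusPeriod f) →
        ((padicValNat 3 (Nat.card (AddCommGroup.primaryComponent W.sha 3)) +
            padicValNat 3 W.tamagawaProduct : ℕ) : ℕ∞) ≤ kuriharaPartial W 3 f 0 := by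
  intro W _ _ htower hfin N _ f hf _ hgood hmult hpot hper
  by_cases h0 : ratPlusSymbol f 0 = 0
  · rw [kuriharaPartial_zero_eq_top_of_ratPlusSymbol_eq_zero W 3 f h0]
    exact le_top
  · obtain ⟨q, hq, hle⟩ := hKato W 3 (by norm_num) hgood hmult hpot
      (Kato2004.imageContainsSL2_of_forall_hasSurjectiveModNGaloisRep W 3 htower)
      (hf.entireLFunction_one_ne_zero_of_ratPlusSymbol_zero_ne_zero h0) hfin
    exact natCast_le_kuriharaPartial_zero_of_le_padicValRat W 3 f (by norm_num)
      (irreducible_three_of_tower W htower) hf hper hq (by rw [Nat.cast_add]; exact hle)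

/-- **Rigidity crux + Tamagawa-exact Kato ⟹ `v₃(∏ c_ℓ) ≤ ∂^{(∞)}_{deep}(δ̃)`** on Kato's stratum:
`DeepLowerAtThree` gives `∂⁽⁰⁾ ≤ ord₃ #Ш(3) + d` with `∂^{(∞)}_{deep} = d`, the reading above gives
`ord₃ #Ш(3) + v₃(∏ c_ℓ) ≤ ∂⁽⁰⁾`, whence `v₃(∏ c_ℓ) ≤ d` — one half of Kim's prediction
`∂^{(∞)} = Σ_ℓ v_p(c_ℓ)` (AJM 148 Conj. 1.10) at `p = 3`, CONDITIONAL on the crux (hypothesis `hL` by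
name) and the named fact. [cite: Kim2022StructureSelmer, Conj. 1.10 (PDF p. 8)]
[cite: Kato2004Asterisque, Thm. 14.5 (3) (p. 236), Prop. 14.16 (2) (p. 244), §14.8 (p. 238)] -/
theorem tamagawa_le_kuriharaPartialDeepInfty_of_deepLowerAtThree_of_kato2004TamagawaExact
    (hL : DeepLowerAtThree)
    (hKato : Kato2004.rankZero_padicValNat_sha_add_padicValNat_tamagawa_le_of_additive_potGood_of_imageContainsSL2) :
    ∀ (W : WeierstrassCurve ℚ) [W.IsElliptic] [W.IsGloballyMinimal],
      (∀ n : ℕ, W.HasSurjectiveModNGaloisRep (3 ^ n : ℕ)) →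
      Finite W.sha →
      ∀ {N : ℕ} [NeZero N] (f : CuspForm (Gamma0 N) 2), IsNewformOf W f →
      (∀ r : ℚ, ratPlusSymbol f r ≠ 0 → 0 ≤ padicValRat 3 (ratPlusSymbol f r)) →
      kuriharaVanishingOrder W 3 f = 0 →
      ¬ W.HasGoodReductionAtPrime 3 → ¬ W.HasMultiplicativeReductionAtPrime 3 →
      0 ≤ padicValRat 3 W.j →
      (∃ u : ℚ, ‖(u : ℚ_[3])‖ = 1 ∧ W.realPeriodRat = u * plusPeriod f) →
        ((padicValNat 3 W.tamagawaProduct : ℕ) : ℕ∞) ≤ kuriharaPartialDeepInfty W 3 f := by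
  intro W _ _ htower hfin N _ f hf hint hord hgood hmult hpot hper
  obtain ⟨d, hd, hle⟩ := hL W htower hfin f hf hint hord
  have hge := sha_add_tamagawa_le_kuriharaPartial_zero_of_kato2004TamagawaExact hKato W htower hfin f
    hf hord hgood hmult hpot hper
  have h : ((padicValNat 3 (Nat.card (AddCommGroup.primaryComponent W.sha 3)) +
      padicValNat 3 W.tamagawaProduct : ℕ) : ℕ∞) ≤
      ((padicValNat 3 (Nat.card (AddCommGroup.primaryComponent W.sha 3)) + d : ℕ) : ℕ∞) :=
    hge.trans hle
  have h' : padicValNat 3 (Nat.card (AddCommGroup.primaryComponent W.sha 3)) +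
      padicValNat 3 W.tamagawaProduct ≤
      padicValNat 3 (Nat.card (AddCommGroup.primaryComponent W.sha 3)) + d := by
    exact_mod_cast h
  rw [hd]
  exact_mod_cast Nat.le_of_add_le_add_left h'

end Summit.BirchSwinnertonDyer.BirchSwinnertonDyer.Theorems.KimAtThreeKolyvaginDeepUpperRung

end
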